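import Mathlib
import Summits.CriticalPhenomena.Ising3DConformalLimit.Theses.GaussianScaleMixture
import Literature.Analysis.SpecialFunctions.IsStieltjesFunction

/-!
# Sketch — crux-ideate stmt-CriticalPhenomena-8366 (GSMRigidity), ideator 2, round 1

First-lemma signatures for three crux idea cards (statements only; `sorry` bodies).

* Card A `momentum-one-amplitude`: `entire_halfpi_periodic_of_cosh_growth_const` (rigid equator,
  abstract form), `stieltjes_sector_bound` (the quantitative Stieltjes input),
  `weighted_oneAmplitude_momentum` (OneAmplitudeIsotropy transported to `K̂`).
* Card L2 `swap-pencil-branch-arc`: `shearedSymbol_noRoot_rightHalfPlane_iff`.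
* Card L1 `imaginary-mirror-time-arc`: `laplace_verticalLine_bound`, `circle_meanValue_exp`
  (tightness: full circles DO cancel).
-/

noncomputable section

open scoped BigOperators Real
open MeasureTheory Set Complex

namespace Summit.CriticalPhenomena.Ising3DConformalLimit.Cruxes.GSMRigidity.Ideator2

/-- Card A, first lemma (rigid equator, abstract form): an entire `π/2`-periodic function with
`‖f z‖ ≤ A cosh (2 Im z)` is constant (Fourier modes `e^{4imz}`, `m ≠ 0`, would grow like
`e^{4|Im z|}`). Applied to the angular symbol `C = |k|^{2a} K̂` on the equator `{k₃ = 0}`,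
continued through the `e₁`- and `(e₁+e₂)/√2`-pencils. -/
theorem entire_halfpi_periodic_of_cosh_growth_const (f : ℂ → ℂ) (A : ℝ)
    (hf : Differentiable ℂ f) (hper : ∀ z : ℂ, f (z + (Real.pi / 2 : ℝ)) = f z)
    (hgrowth : ∀ z : ℂ, ‖f z‖ ≤ A * Real.cosh (2 * z.im)) :
    ∀ z w : ℂ, f z = f w := by
  sorry

/-- Card A, quantitative input (Stieltjes sector bound): the complex extension of a Stieltjes
function with data `(a, b, σ)` is dominated off the cut by its value at `|z|` divided by
`cos (arg z / 2)`. -/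
theorem stieltjes_sector_bound (a b : ℝ) (σ : Measure ℝ) (ha : 0 ≤ a) (hb : 0 ≤ b)
    (hσ : σ (Iic 0) = 0) (hint : Integrable (fun t : ℝ => (1 + t)⁻¹) σ)
    (z : ℂ) (hz : 0 < z.re ∨ z.im ≠ 0) :
    ‖(a : ℂ) / z + b + ∫ t, ((z + (t : ℂ))⁻¹) ∂σ‖
      ≤ (a / ‖z‖ + b + ∫ t, (‖z‖ + t)⁻¹ ∂σ) / Real.cos (Complex.arg z / 2) := by
  sorry

/-- Card A, the collapse (OneAmplitudeIsotropy transported to momentum space): for an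
exchangeable mixing measure `ν` on the open octant, the Fourier-side amplitudes
`K̂(e₁) = π^{3/2} ∫ (s₀s₁s₂)^{-1/2} e^{-1/(4s₀)} dν` and `K̂((e₁+e₂)/√2)` satisfy axis ≥ diagonal,
with equality only if `ν` is carried by `{s₀ = s₁}`. -/
theorem weighted_oneAmplitude_momentum (ν : Measure (Fin 3 → ℝ))
    (hpos : ν {s | ∃ i, s i ≤ 0} = 0)
    (hex : ∀ τ : Equiv.Perm (Fin 3), ν.map (fun s : Fin 3 → ℝ => s ∘ τ) = ν)
    (hint : Integrable (fun s : Fin 3 → ℝ =>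
      (s 0 * s 1 * s 2) ^ (-(1/2 : ℝ)) * Real.exp (-(1 / (4 * s 0)))) ν)
    (heq : ∫ s, (s 0 * s 1 * s 2) ^ (-(1/2 : ℝ)) * Real.exp (-(1 / (4 * s 0))) ∂ν
        = ∫ s, (s 0 * s 1 * s 2) ^ (-(1/2 : ℝ))
            * Real.exp (-((1 / (4 * s 0) + 1 / (4 * s 1)) / 2)) ∂ν) :
    ν {s | s 0 ≠ s 1} = 0 := by
  sorry

/-- Card L2, first lemma (where the sheared symbol is singular): on the swap pencil
`k = √s (e₁-e₂)/√2 + q (e₁+e₂)/√2` the quadratic `b₁k₁² + b₂k₂² = α s + (b₁-b₂) q √s + α q²`,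
`α = (b₁+b₂)/2`, has a zero with `Re √s > 0` (i.e. a branch point of `(k·Bk)^{-a}` on the
principal sheet of `ℂ ∖ (-∞,0]`) iff `b₁ < b₂`; both roots lie on `|√s| = q`. -/
theorem shearedSymbol_noRoot_rightHalfPlane_iff (b₁ b₂ q : ℝ) (hb₁ : 0 < b₁) (hb₂ : 0 < b₂)
    (hq : 0 < q) :
    (∀ w : ℂ, 0 < w.re →
        ((b₁ + b₂) / 2 : ℝ) * w ^ 2 + ((b₁ - b₂) * q : ℝ) * w + ((b₁ + b₂) / 2 * q ^ 2 : ℝ) ≠ 0)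
      ↔ b₂ ≤ b₁ := by
  sorry

/-- Card L1, first lemma (completely monotone ⇒ bounded at imaginary time): the Laplace
transform of a positive measure on `[0,∞)` is bounded on each vertical line by its value at the
real foot-point. -/
theorem laplace_verticalLine_bound (μ : Measure ℝ) (hμ : μ (Iio 0) = 0) (t₀ u : ℝ)
    (hint : Integrable (fun x : ℝ => Real.exp (-(t₀ * x))) μ) :
    ‖∫ x, Complex.exp (-((t₀ : ℂ) + u * I) * x) ∂μ‖ ≤ ∫ x, Real.exp (-(t₀ * x)) ∂μ := by
  sorry

/-- Card L1, tightness (why "complex spectral mass ⇒ not CM" needs the ARC geometry): the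
uniform measure on a full circle `|z - c| = r` has the completely monotone Laplace transform
`2π e^{-tc}` (mean-value property) although every point of it is non-real. -/
theorem circle_meanValue_exp (c r t : ℝ) :
    ∫ φ in (0 : ℝ)..(2 * Real.pi),
        Complex.exp (-(t : ℂ) * ((c : ℂ) + r * Complex.exp (φ * I)))
      = 2 * Real.pi * Complex.exp (-(t : ℂ) * c) := by
  sorry

/-- Sanity: the crux decl is in scope. -/
example : Prop := Summit.CriticalPhenomena.Ising3DConformalLimit.Theses.GaussianScaleMixture.GSMRigidity

end Summit.CriticalPhenomena.Ising3DConformalLimit.Cruxes.GSMRigidity.Ideator2
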